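import Mathlib.Analysis.SpecialFunctions.Gamma.Deligne
import Mathlib.Analysis.Complex.CauchyIntegral
import Mathlib.Analysis.Analytic.Uniqueness
import HarnessLib

/-!
# Reading off the exponents of a `Γ`-factor (uniqueness of the archimedean factor in a functional equation)

Topic `Literature/NumberTheory/LFunctions`; namespace `Literature.NumberTheory.LFunctions`.  Pure complex
analysis about Deligne's `Γ_ℝ(s) = π^{-s/2} Γ(s/2)` (Mathlib `Complex.Gammaℝ`), used by
`Automorphic/ArtinRankOneGammaFactorProofs` to identify the `Γ`-factor of a ray class character with the
`Γ`-factor of the Artin character it comes from (the archimedean part of Artin reciprocity, proved there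
analytically): two completed L-functions built on the *same* Dirichlet series with `Γ`-factors
`Γ_ℝ(s)^{a} Γ_ℝ(s+1)^{b}` can both satisfy a functional equation `s ↔ 1 - s` only if the exponents agree.

Everything is phrased with the **entire** function `s ↦ Γ_ℝ(s)⁻¹` (Mathlib `Complex.differentiable_Gammaℝ_inv`),
whose zeros are simple and sit at `0, -2, -4, …` (`Complex.Gammaℝ_eq_zero_iff`, `Complex.Gammaℝ_residue_zero`),
so that no poles ever occur: an identity between products of such factors and exponentials, known on the
half-plane `re s > 1`, persists on `ℂ` (identity theorem) and the exponents are read off from the orders of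
vanishing at `s = 0` (for `Γ_ℝ(s)⁻¹`) and at `s = -1` (for `Γ_ℝ(s+1)⁻¹`).

Main results (all proved, no definitions; the identity theorem step is Mathlib's
`AnalyticOnNhd.eq_of_eventuallyEq`, as in `Automorphic.eq_of_differentiable_of_eqOn_one_lt_re`):

* `natExp_eq_of_eventually_pow_mul_eq` — if `w^k f = w^l g` near a simple-zero-type point of `w` with
  `f, g` continuous and non-zero there, then `k = l`;
* `gammaExponents_eq_of_eqOn` — `A₁^{s/2} Γ_ℝ(s)^{-a} Γ_ℝ(s+1)^{-b} = A₂^{s/2} Γ_ℝ(s)^{-a'} Γ_ℝ(s+1)^{-b'}`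
  on `re s > 1` forces `a = a'`, `b = b'`;
* `gammaExponents_eq_of_reflection` — the "bracket" identity obtained by comparing two functional equations
  `s ↔ 1 - s` for the same pair of Dirichlet series forces the same equalities.

## References

* Folklore (uniqueness of `Γ`-factors); cf. J. Neukirch, *Algebraic Number Theory*, VII §8 (8.6) and §12
  (12.6) for the functional equations whose archimedean factors are compared. [NeukirchANT1999]
-/

noncomputable section

open Complex Filter Topology Set

namespace Literature.NumberTheory.LFunctions

/-! ### The entire function `Γ_ℝ(s)⁻¹` -/

/-- `Γ_ℝ(s)⁻¹ = 0` exactly at `s = 0, -2, -4, …` (Mathlib's `Γ` takes the junk value `0` at its poles).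
[folklore] -/
theorem inv_Gammaℝ_eq_zero_iff {s : ℂ} : (Gammaℝ s)⁻¹ = 0 ↔ ∃ n : ℕ, s = -(2 * n) := by
  rw [inv_eq_zero, Gammaℝ_eq_zero_iff]

/-- `Γ_ℝ(s)⁻¹ ≠ 0` for `re s > 0`. [folklore] -/
theorem inv_Gammaℝ_ne_zero_of_re_pos {s : ℂ} (hs : 0 < s.re) : (Gammaℝ s)⁻¹ ≠ 0 :=
  inv_ne_zero (Gammaℝ_ne_zero_of_re_pos hs)

/-- `Γ_ℝ(-1)⁻¹ ≠ 0` (`-1` is odd). [folklore] -/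
theorem inv_Gammaℝ_neg_one_ne_zero : (Gammaℝ (-1))⁻¹ ≠ 0 := by
  rw [Ne, inv_Gammaℝ_eq_zero_iff]
  rintro ⟨n, hn⟩
  have h1 : ((2 * n : ℕ) : ℂ) = (1 : ℕ) := by push_cast; linear_combination hn
  have h2 : 2 * n = 1 := by exact_mod_cast h1
  omega

/-- `Γ_ℝ(s)⁻¹ ≠ 0` in the punctured unit disc around `0`. [folklore] -/
theorem inv_Gammaℝ_ne_zero_of_norm_lt_one {s : ℂ} (hs : ‖s‖ < 1) (hs0 : s ≠ 0) : (Gammaℝ s)⁻¹ ≠ 0 := by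
  rw [Ne, inv_Gammaℝ_eq_zero_iff]
  rintro ⟨n, hn⟩
  rcases Nat.eq_zero_or_pos n with h0 | hpos
  · rw [h0] at hn; simp at hn; exact hs0 hn
  · have : ‖s‖ = 2 * n := by
      rw [hn, norm_neg, show (2 * (n : ℂ)) = ((2 * n : ℕ) : ℂ) by push_cast; ring, Complex.norm_natCast]
      push_cast; ring
    rw [this] at hs
    have : (1 : ℝ) ≤ n := by exact_mod_cast hpos
    linarith

/-- `Γ_ℝ(s)⁻¹` vanishes at `0`. [folklore] -/
theorem inv_Gammaℝ_zero : (Gammaℝ 0)⁻¹ = 0 :=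
  inv_Gammaℝ_eq_zero_iff.mpr ⟨0, by simp⟩

/-- Near `0` (punctured), `Γ_ℝ(s)⁻¹ ≠ 0`. [folklore] -/
theorem eventually_inv_Gammaℝ_ne_zero : ∀ᶠ s in 𝓝[≠] (0 : ℂ), (Gammaℝ s)⁻¹ ≠ 0 := by
  have h1 : ∀ᶠ s in 𝓝[≠] (0 : ℂ), ‖s‖ < 1 := by
    have : Metric.ball (0 : ℂ) 1 ∈ 𝓝 (0 : ℂ) := Metric.ball_mem_nhds _ one_pos
    filter_upwards [mem_nhdsWithin_of_mem_nhds this] with s hs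
    simpa using hs
  have h2 : ∀ᶠ s in 𝓝[≠] (0 : ℂ), s ≠ 0 := eventually_mem_nhdsWithin
  filter_upwards [h1, h2] with s hs hs0 using inv_Gammaℝ_ne_zero_of_norm_lt_one hs hs0

/-- Near `-1` (punctured), `Γ_ℝ(s+1)⁻¹ ≠ 0`. [folklore] -/
theorem eventually_inv_Gammaℝ_add_one_ne_zero : ∀ᶠ s in 𝓝[≠] (-1 : ℂ), (Gammaℝ (s + 1))⁻¹ ≠ 0 := by
  have h1 : ∀ᶠ s in 𝓝[≠] (-1 : ℂ), ‖s + 1‖ < 1 := by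
    have : Metric.ball (-1 : ℂ) 1 ∈ 𝓝 (-1 : ℂ) := Metric.ball_mem_nhds _ one_pos
    filter_upwards [mem_nhdsWithin_of_mem_nhds this] with s hs
    rw [Metric.mem_ball, dist_eq_norm, sub_neg_eq_add] at hs
    exact hs
  have h2 : ∀ᶠ s in 𝓝[≠] (-1 : ℂ), s ≠ -1 := eventually_mem_nhdsWithin
  filter_upwards [h1, h2] with s hs hs0
  exact inv_Gammaℝ_ne_zero_of_norm_lt_one hs (fun h => hs0 (by linear_combination h))

/-- `s ↦ Γ_ℝ(f s)⁻¹` is entire for entire `f` (e.g. `s ↦ Γ_ℝ(c + s)⁻¹`, `s ↦ Γ_ℝ(c - s)⁻¹`); the case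
`f = id` is Mathlib's `Complex.differentiable_Gammaℝ_inv`. [folklore] -/
theorem differentiable_inv_Gammaℝ_comp {f : ℂ → ℂ} (hf : Differentiable ℂ f) :
    Differentiable ℂ fun s : ℂ => (Gammaℝ (f s))⁻¹ :=
  differentiable_Gammaℝ_inv.comp hf

/-- `s ↦ A^{f(s)}` is entire for `A ≠ 0`. [folklore] -/
theorem differentiable_const_cpow_comp {A : ℂ} (hA : A ≠ 0) {f : ℂ → ℂ} (hf : Differentiable ℂ f) :
    Differentiable ℂ fun s : ℂ => A ^ f s :=
  fun s => (hf s).const_cpow (Or.inl hA)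

/-! ### Comparing orders of vanishing -/

/-- **Exponent comparison at a zero.**  Let `w` be continuous at `z₀` with `w z₀ = 0` and `w ≠ 0` on a
punctured neighbourhood, and `f, g` continuous at `z₀` with `f z₀ ≠ 0`, `g z₀ ≠ 0`.  If
`w^k f = w^l g` on a punctured neighbourhood of `z₀`, then `k = l` (otherwise, cancelling the smaller
power, one side tends to `0` and the other to a non-zero limit). [folklore] -/
theorem natExp_eq_of_eventually_pow_mul_eq {w f g : ℂ → ℂ} {z₀ : ℂ} {k l : ℕ}
    (hw : ContinuousAt w z₀) (hw0 : w z₀ = 0) (hw' : ∀ᶠ s in 𝓝[≠] z₀, w s ≠ 0)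
    (hf : ContinuousAt f z₀) (hg : ContinuousAt g z₀) (hf0 : f z₀ ≠ 0) (hg0 : g z₀ ≠ 0)
    (h : ∀ᶠ s in 𝓝[≠] z₀, w s ^ k * f s = w s ^ l * g s) : k = l := by
  suffices key : ∀ {k l : ℕ} {f g : ℂ → ℂ}, ContinuousAt f z₀ → ContinuousAt g z₀ → g z₀ ≠ 0 →
      (∀ᶠ s in 𝓝[≠] z₀, w s ^ k * f s = w s ^ l * g s) → ¬ l < k by
    rcases lt_trichotomy k l with hkl | hkl | hkl
    · exact absurd hkl (key hg hf hf0 (h.mono fun s hs => hs.symm))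
    · exact hkl
    · exact absurd hkl (key hf hg hg0 h)
  intro k l f g hf hg hg0 h hlk
  have h' : ∀ᶠ s in 𝓝[≠] z₀, w s ^ (k - l) * f s = g s := by
    filter_upwards [h, hw'] with s hs hws
    have hk : w s ^ k = w s ^ l * w s ^ (k - l) := by rw [← pow_add, Nat.add_sub_cancel' hlk.le]
    rw [hk, mul_assoc] at hs
    exact mul_left_cancel₀ (pow_ne_zero _ hws) hs
  have hL : Tendsto (fun s => w s ^ (k - l) * f s) (𝓝[≠] z₀) (𝓝 0) := by
    have h1 : Tendsto (fun s => w s ^ (k - l) * f s) (𝓝 z₀) (𝓝 (w z₀ ^ (k - l) * f z₀)) :=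
      (hw.pow _).mul hf
    rw [hw0, zero_pow (Nat.sub_ne_zero_of_lt hlk), zero_mul] at h1
    exact h1.mono_left nhdsWithin_le_nhds
  have hR : Tendsto g (𝓝[≠] z₀) (𝓝 (g z₀)) := hg.tendsto.mono_left nhdsWithin_le_nhds
  exact hg0 (tendsto_nhds_unique_of_eventuallyEq hL hR h').symm

/-! ### Reading off exponents: one `Γ`-product against another -/

/-- **Exponents of a `Γ`-factor are determined** (direct comparison): if
`A₁^{s/2} Γ_ℝ(s)^{-a} Γ_ℝ(s+1)^{-b} = A₂^{s/2} Γ_ℝ(s)^{-a'} Γ_ℝ(s+1)^{-b'}` for `re s > 1` with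
`A₁, A₂ ≠ 0`, then `a = a'` and `b = b'`: both sides are entire, so the identity holds on `ℂ`; compare
orders of vanishing at `s = 0` and at `s = -1`. [folklore] -/
theorem gammaExponents_eq_of_eqOn {a b a' b' : ℕ} {A₁ A₂ : ℂ} (hA₁ : A₁ ≠ 0) (hA₂ : A₂ ≠ 0)
    (h : ∀ s : ℂ, 1 < s.re →
      A₁ ^ (s / 2) * (Gammaℝ s)⁻¹ ^ a * (Gammaℝ (s + 1))⁻¹ ^ b =
        A₂ ^ (s / 2) * (Gammaℝ s)⁻¹ ^ a' * (Gammaℝ (s + 1))⁻¹ ^ b') :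
    a = a' ∧ b = b' := by
  set F : ℂ → ℂ := fun s => A₁ ^ (s / 2) * (Gammaℝ s)⁻¹ ^ a * (Gammaℝ (s + 1))⁻¹ ^ b with hF
  set G : ℂ → ℂ := fun s => A₂ ^ (s / 2) * (Gammaℝ s)⁻¹ ^ a' * (Gammaℝ (s + 1))⁻¹ ^ b' with hG
  have hdiv : Differentiable ℂ fun s : ℂ => s / 2 := differentiable_id.div_const 2
  have hadd : Differentiable ℂ fun s : ℂ => s + 1 := differentiable_id.add_const 1
  have hFd : Differentiable ℂ F :=
    ((differentiable_const_cpow_comp hA₁ hdiv).mul (differentiable_Gammaℝ_inv.pow a)).mul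
      ((differentiable_inv_Gammaℝ_comp hadd).pow b)
  have hGd : Differentiable ℂ G :=
    ((differentiable_const_cpow_comp hA₂ hdiv).mul (differentiable_Gammaℝ_inv.pow a')).mul
      ((differentiable_inv_Gammaℝ_comp hadd).pow b')
  have hFG : F = G := by
    -- identity theorem for entire functions (`Automorphic.eq_of_differentiable_of_eqOn_one_lt_re`,
    -- inlined to keep this file's imports inside Mathlib)
    refine AnalyticOnNhd.eq_of_eventuallyEq (𝕜 := ℂ) (z₀ := (2 : ℂ))
      (analyticOnNhd_univ_iff_differentiable.mpr hFd) (analyticOnNhd_univ_iff_differentiable.mpr hGd) ?_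
    refine eventually_of_mem ?_ (fun t (ht : 1 < t.re) => h t ht)
    exact (continuous_re.isOpen_preimage _ isOpen_Ioi).mem_nhds (by simp : 1 < (2 : ℂ).re)
  have hpt : ∀ s, F s = G s := fun s => by rw [hFG]
  constructor
  · -- orders at `s = 0`, with `w = Γ_ℝ(s)⁻¹`
    refine natExp_eq_of_eventually_pow_mul_eq (z₀ := 0) (w := fun s => (Gammaℝ s)⁻¹)
      (f := fun s => A₁ ^ (s / 2) * (Gammaℝ (s + 1))⁻¹ ^ b)
      (g := fun s => A₂ ^ (s / 2) * (Gammaℝ (s + 1))⁻¹ ^ b')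
      (differentiable_Gammaℝ_inv 0).continuousAt inv_Gammaℝ_zero eventually_inv_Gammaℝ_ne_zero
      (((differentiable_const_cpow_comp hA₁ hdiv).mul ((differentiable_inv_Gammaℝ_comp hadd).pow b)) 0).continuousAt
      (((differentiable_const_cpow_comp hA₂ hdiv).mul ((differentiable_inv_Gammaℝ_comp hadd).pow b')) 0).continuousAt
      ?_ ?_ (Eventually.of_forall fun s => ?_)
    · simp only [zero_div, cpow_zero, one_mul, zero_add]
      exact pow_ne_zero _ (inv_Gammaℝ_ne_zero_of_re_pos (by simp))
    · simp only [zero_div, cpow_zero, one_mul, zero_add]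
      exact pow_ne_zero _ (inv_Gammaℝ_ne_zero_of_re_pos (by simp))
    · have := hpt s
      simp only [hF, hG] at this
      calc (Gammaℝ s)⁻¹ ^ a * (A₁ ^ (s / 2) * (Gammaℝ (s + 1))⁻¹ ^ b)
          = A₁ ^ (s / 2) * (Gammaℝ s)⁻¹ ^ a * (Gammaℝ (s + 1))⁻¹ ^ b := by ring
        _ = A₂ ^ (s / 2) * (Gammaℝ s)⁻¹ ^ a' * (Gammaℝ (s + 1))⁻¹ ^ b' := this
        _ = (Gammaℝ s)⁻¹ ^ a' * (A₂ ^ (s / 2) * (Gammaℝ (s + 1))⁻¹ ^ b') := by ring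
  · -- orders at `s = -1`, with `w = Γ_ℝ(s+1)⁻¹`
    refine natExp_eq_of_eventually_pow_mul_eq (z₀ := -1) (w := fun s => (Gammaℝ (s + 1))⁻¹)
      (f := fun s => A₁ ^ (s / 2) * (Gammaℝ s)⁻¹ ^ a)
      (g := fun s => A₂ ^ (s / 2) * (Gammaℝ s)⁻¹ ^ a')
      (differentiable_inv_Gammaℝ_comp hadd (-1)).continuousAt (by simp [inv_Gammaℝ_zero])
      eventually_inv_Gammaℝ_add_one_ne_zero
      (((differentiable_const_cpow_comp hA₁ hdiv).mul (differentiable_Gammaℝ_inv.pow a)) (-1)).continuousAt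
      (((differentiable_const_cpow_comp hA₂ hdiv).mul (differentiable_Gammaℝ_inv.pow a')) (-1)).continuousAt
      ?_ ?_ (Eventually.of_forall fun s => ?_)
    · exact mul_ne_zero (cpow_ne_zero_iff.mpr (Or.inl hA₁)) (pow_ne_zero _ inv_Gammaℝ_neg_one_ne_zero)
    · exact mul_ne_zero (cpow_ne_zero_iff.mpr (Or.inl hA₂)) (pow_ne_zero _ inv_Gammaℝ_neg_one_ne_zero)
    · have := hpt s
      simp only [hF, hG] at this
      calc (Gammaℝ (s + 1))⁻¹ ^ b * (A₁ ^ (s / 2) * (Gammaℝ s)⁻¹ ^ a)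
          = A₁ ^ (s / 2) * (Gammaℝ s)⁻¹ ^ a * (Gammaℝ (s + 1))⁻¹ ^ b := by ring
        _ = A₂ ^ (s / 2) * (Gammaℝ s)⁻¹ ^ a' * (Gammaℝ (s + 1))⁻¹ ^ b' := this
        _ = (Gammaℝ (s + 1))⁻¹ ^ b' * (A₂ ^ (s / 2) * (Gammaℝ s)⁻¹ ^ a') := by ring

/-! ### Reading off exponents: two functional equations for the same pair of L-series -/

/-- **Exponents of a `Γ`-factor are determined by the functional equation.**  Comparing two functional
equations `s ↔ 1 - s` for the same pair of Dirichlet series, one with `Γ`-factor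
`A^{s/2} Γ_ℝ(s)^{α} Γ_ℝ(s+1)^{β}` and one with `d^{s/2} Γ_ℝ(s)^{α'} Γ_ℝ(s+1)^{β'}`, leads (after clearing
the L-series, `Automorphic/ArtinRankOneGammaFactorProofs`) to the identity
`W A^{s/2} d^{(1-s)/2} Γ_ℝ(1-s)^{-α} Γ_ℝ(2-s)^{-β} Γ_ℝ(s)^{-α'} Γ_ℝ(s+1)^{-β'}
  = A^{(1-s)/2} d^{s/2} Γ_ℝ(s)^{-α} Γ_ℝ(s+1)^{-β} Γ_ℝ(1-s)^{-α'} Γ_ℝ(2-s)^{-β'}` on `re s > 1`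
(`W ≠ 0` the ratio of root numbers).  Then `α = α'` and `β = β'`: both sides are entire; compare the
orders of vanishing at `s = 0` (only `Γ_ℝ(s)⁻¹` vanishes there) and at `s = -1` (only `Γ_ℝ(s+1)⁻¹`).
[folklore] -/
theorem gammaExponents_eq_of_reflection {α β α' β' : ℕ} {W A d : ℂ} (hW : W ≠ 0) (hA : A ≠ 0)
    (hd : d ≠ 0)
    (h : ∀ s : ℂ, 1 < s.re →
      W * A ^ (s / 2) * d ^ ((1 - s) / 2) * (Gammaℝ (1 - s))⁻¹ ^ α * (Gammaℝ (2 - s))⁻¹ ^ β *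
          (Gammaℝ s)⁻¹ ^ α' * (Gammaℝ (s + 1))⁻¹ ^ β' =
        A ^ ((1 - s) / 2) * d ^ (s / 2) * (Gammaℝ s)⁻¹ ^ α * (Gammaℝ (s + 1))⁻¹ ^ β *
          (Gammaℝ (1 - s))⁻¹ ^ α' * (Gammaℝ (2 - s))⁻¹ ^ β') :
    α = α' ∧ β = β' := by
  -- the entire functions of the two sides
  set F : ℂ → ℂ := fun s =>
    W * A ^ (s / 2) * d ^ ((1 - s) / 2) * (Gammaℝ (1 - s))⁻¹ ^ α * (Gammaℝ (2 - s))⁻¹ ^ β *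
      (Gammaℝ s)⁻¹ ^ α' * (Gammaℝ (s + 1))⁻¹ ^ β' with hF
  set G : ℂ → ℂ := fun s =>
    A ^ ((1 - s) / 2) * d ^ (s / 2) * (Gammaℝ s)⁻¹ ^ α * (Gammaℝ (s + 1))⁻¹ ^ β *
      (Gammaℝ (1 - s))⁻¹ ^ α' * (Gammaℝ (2 - s))⁻¹ ^ β' with hG
  have hdiv : Differentiable ℂ fun s : ℂ => s / 2 := differentiable_id.div_const 2
  have hdiv' : Differentiable ℂ fun s : ℂ => (1 - s) / 2 :=
    ((differentiable_const 1).sub differentiable_id).div_const 2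
  have hadd : Differentiable ℂ fun s : ℂ => s + 1 := differentiable_id.add_const 1
  have hsub1 : Differentiable ℂ fun s : ℂ => 1 - s := (differentiable_const 1).sub differentiable_id
  have hsub2 : Differentiable ℂ fun s : ℂ => 2 - s := (differentiable_const 2).sub differentiable_id
  -- differentiable building blocks
  have dA : Differentiable ℂ fun s : ℂ => A ^ (s / 2) := differentiable_const_cpow_comp hA hdiv
  have dA' : Differentiable ℂ fun s : ℂ => A ^ ((1 - s) / 2) := differentiable_const_cpow_comp hA hdiv'
  have dd : Differentiable ℂ fun s : ℂ => d ^ (s / 2) := differentiable_const_cpow_comp hd hdiv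
  have dd' : Differentiable ℂ fun s : ℂ => d ^ ((1 - s) / 2) := differentiable_const_cpow_comp hd hdiv'
  have i0 : Differentiable ℂ fun s : ℂ => (Gammaℝ s)⁻¹ := differentiable_Gammaℝ_inv
  have i1 : Differentiable ℂ fun s : ℂ => (Gammaℝ (s + 1))⁻¹ := differentiable_inv_Gammaℝ_comp hadd
  have i2 : Differentiable ℂ fun s : ℂ => (Gammaℝ (1 - s))⁻¹ := differentiable_inv_Gammaℝ_comp hsub1
  have i3 : Differentiable ℂ fun s : ℂ => (Gammaℝ (2 - s))⁻¹ := differentiable_inv_Gammaℝ_comp hsub2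
  have hFd : Differentiable ℂ F :=
    (((((((differentiable_const W).mul dA).mul dd').mul (i2.pow α)).mul (i3.pow β)).mul (i0.pow α')).mul
      (i1.pow β'))
  have hGd : Differentiable ℂ G :=
    (((((dA'.mul dd).mul (i0.pow α)).mul (i1.pow β)).mul (i2.pow α')).mul (i3.pow β'))
  have hFG : F = G := by
    -- identity theorem for entire functions (`Automorphic.eq_of_differentiable_of_eqOn_one_lt_re`,
    -- inlined to keep this file's imports inside Mathlib)
    refine AnalyticOnNhd.eq_of_eventuallyEq (𝕜 := ℂ) (z₀ := (2 : ℂ))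
      (analyticOnNhd_univ_iff_differentiable.mpr hFd) (analyticOnNhd_univ_iff_differentiable.mpr hGd) ?_
    refine eventually_of_mem ?_ (fun t (ht : 1 < t.re) => h t ht)
    exact (continuous_re.isOpen_preimage _ isOpen_Ioi).mem_nhds (by simp : 1 < (2 : ℂ).re)
  have hpt : ∀ s, F s = G s := fun s => by rw [hFG]
  -- non-vanishing of the harmless factors at `0` and `-1`
  have hcp : ∀ {c : ℂ} (hc : c ≠ 0) (t : ℂ), c ^ t ≠ 0 := fun hc t => cpow_ne_zero_iff.mpr (Or.inl hc)
  constructor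
  · -- at `s = 0`: `F = ι(s)^{α'} f`, `G = ι(s)^{α} g`
    symm
    refine natExp_eq_of_eventually_pow_mul_eq (z₀ := 0) (w := fun s => (Gammaℝ s)⁻¹)
      (f := fun s => W * A ^ (s / 2) * d ^ ((1 - s) / 2) * (Gammaℝ (1 - s))⁻¹ ^ α *
        (Gammaℝ (2 - s))⁻¹ ^ β * (Gammaℝ (s + 1))⁻¹ ^ β')
      (g := fun s => A ^ ((1 - s) / 2) * d ^ (s / 2) * (Gammaℝ (s + 1))⁻¹ ^ β *
        (Gammaℝ (1 - s))⁻¹ ^ α' * (Gammaℝ (2 - s))⁻¹ ^ β')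
      (i0 0).continuousAt inv_Gammaℝ_zero eventually_inv_Gammaℝ_ne_zero
      (((((((differentiable_const W).mul dA).mul dd').mul (i2.pow α)).mul (i3.pow β)).mul
        (i1.pow β')) 0).continuousAt
      (((((dA'.mul dd).mul (i1.pow β)).mul (i2.pow α')).mul (i3.pow β')) 0).continuousAt
      ?_ ?_ (Eventually.of_forall fun s => ?_)
    · exact mul_ne_zero (mul_ne_zero (mul_ne_zero (mul_ne_zero (mul_ne_zero hW (hcp hA _)) (hcp hd _))
        (pow_ne_zero _ (inv_Gammaℝ_ne_zero_of_re_pos (by norm_num))))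
        (pow_ne_zero _ (inv_Gammaℝ_ne_zero_of_re_pos (by norm_num))))
        (pow_ne_zero _ (inv_Gammaℝ_ne_zero_of_re_pos (by norm_num)))
    · exact mul_ne_zero (mul_ne_zero (mul_ne_zero (mul_ne_zero (hcp hA _) (hcp hd _))
        (pow_ne_zero _ (inv_Gammaℝ_ne_zero_of_re_pos (by norm_num))))
        (pow_ne_zero _ (inv_Gammaℝ_ne_zero_of_re_pos (by norm_num))))
        (pow_ne_zero _ (inv_Gammaℝ_ne_zero_of_re_pos (by norm_num)))
    · have := hpt s
      simp only [hF, hG] at this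
      calc (Gammaℝ s)⁻¹ ^ α' * (W * A ^ (s / 2) * d ^ ((1 - s) / 2) * (Gammaℝ (1 - s))⁻¹ ^ α *
            (Gammaℝ (2 - s))⁻¹ ^ β * (Gammaℝ (s + 1))⁻¹ ^ β')
          = W * A ^ (s / 2) * d ^ ((1 - s) / 2) * (Gammaℝ (1 - s))⁻¹ ^ α * (Gammaℝ (2 - s))⁻¹ ^ β *
            (Gammaℝ s)⁻¹ ^ α' * (Gammaℝ (s + 1))⁻¹ ^ β' := by ring
        _ = _ := this
        _ = (Gammaℝ s)⁻¹ ^ α * (A ^ ((1 - s) / 2) * d ^ (s / 2) * (Gammaℝ (s + 1))⁻¹ ^ β *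
            (Gammaℝ (1 - s))⁻¹ ^ α' * (Gammaℝ (2 - s))⁻¹ ^ β') := by ring
  · -- at `s = -1`: `F = ι(s+1)^{β'} f`, `G = ι(s+1)^{β} g`
    symm
    refine natExp_eq_of_eventually_pow_mul_eq (z₀ := -1) (w := fun s => (Gammaℝ (s + 1))⁻¹)
      (f := fun s => W * A ^ (s / 2) * d ^ ((1 - s) / 2) * (Gammaℝ (1 - s))⁻¹ ^ α *
        (Gammaℝ (2 - s))⁻¹ ^ β * (Gammaℝ s)⁻¹ ^ α')
      (g := fun s => A ^ ((1 - s) / 2) * d ^ (s / 2) * (Gammaℝ s)⁻¹ ^ α *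
        (Gammaℝ (1 - s))⁻¹ ^ α' * (Gammaℝ (2 - s))⁻¹ ^ β')
      (i1 (-1)).continuousAt (by simp [inv_Gammaℝ_zero]) eventually_inv_Gammaℝ_add_one_ne_zero
      (((((((differentiable_const W).mul dA).mul dd').mul (i2.pow α)).mul (i3.pow β)).mul
        (i0.pow α')) (-1)).continuousAt
      (((((dA'.mul dd).mul (i0.pow α)).mul (i2.pow α')).mul (i3.pow β')) (-1)).continuousAt
      ?_ ?_ (Eventually.of_forall fun s => ?_)
    · exact mul_ne_zero (mul_ne_zero (mul_ne_zero (mul_ne_zero (mul_ne_zero hW (hcp hA _)) (hcp hd _))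
        (pow_ne_zero _ (inv_Gammaℝ_ne_zero_of_re_pos (by norm_num))))
        (pow_ne_zero _ (inv_Gammaℝ_ne_zero_of_re_pos (by norm_num))))
        (pow_ne_zero _ inv_Gammaℝ_neg_one_ne_zero)
    · exact mul_ne_zero (mul_ne_zero (mul_ne_zero (mul_ne_zero (hcp hA _) (hcp hd _))
        (pow_ne_zero _ inv_Gammaℝ_neg_one_ne_zero))
        (pow_ne_zero _ (inv_Gammaℝ_ne_zero_of_re_pos (by norm_num))))
        (pow_ne_zero _ (inv_Gammaℝ_ne_zero_of_re_pos (by norm_num)))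
    · have := hpt s
      simp only [hF, hG] at this
      calc (Gammaℝ (s + 1))⁻¹ ^ β' * (W * A ^ (s / 2) * d ^ ((1 - s) / 2) * (Gammaℝ (1 - s))⁻¹ ^ α *
            (Gammaℝ (2 - s))⁻¹ ^ β * (Gammaℝ s)⁻¹ ^ α')
          = W * A ^ (s / 2) * d ^ ((1 - s) / 2) * (Gammaℝ (1 - s))⁻¹ ^ α * (Gammaℝ (2 - s))⁻¹ ^ β *
            (Gammaℝ s)⁻¹ ^ α' * (Gammaℝ (s + 1))⁻¹ ^ β' := by ring
        _ = _ := this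
        _ = (Gammaℝ (s + 1))⁻¹ ^ β * (A ^ ((1 - s) / 2) * d ^ (s / 2) * (Gammaℝ s)⁻¹ ^ α *
            (Gammaℝ (1 - s))⁻¹ ^ α' * (Gammaℝ (2 - s))⁻¹ ^ β') := by ring

/-! ### Deligne's `Γ_ℂ` in terms of `Γ_ℝ⁻¹` -/

/-- `Γ_ℂ(s)⁻¹ = Γ_ℝ(s)⁻¹ Γ_ℝ(s+1)⁻¹` (Legendre duplication, Mathlib `Complex.Gammaℝ_mul_Gammaℝ_add_one`;
an identity of entire functions, valid at the zeros too). [folklore] -/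
theorem inv_Gammaℂ_eq (s : ℂ) : (Gammaℂ s)⁻¹ = (Gammaℝ s)⁻¹ * (Gammaℝ (s + 1))⁻¹ := by
  rw [← Gammaℝ_mul_Gammaℝ_add_one, mul_inv]

/-- `Γ_ℝ(s) ≠ 0` and `Γ_ℝ(s+1) ≠ 0` for `re s > 0`; then `Γ_ℝ(s)^a Γ_ℝ(s+1)^b Γ_ℂ(s)^c` times
`Γ_ℝ(s)^{-(a+c)} Γ_ℝ(s+1)^{-(b+c)}` is `1`. [folklore] -/
theorem gammaProduct_mul_inv_pow_eq_one {s : ℂ} (hs : 0 < s.re) (a b c : ℕ) :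
    Gammaℝ s ^ a * Gammaℝ (s + 1) ^ b * Gammaℂ s ^ c *
      ((Gammaℝ s)⁻¹ ^ (a + c) * (Gammaℝ (s + 1))⁻¹ ^ (b + c)) = 1 := by
  have h0 : Gammaℝ s ≠ 0 := Gammaℝ_ne_zero_of_re_pos hs
  have h1 : Gammaℝ (s + 1) ≠ 0 := Gammaℝ_ne_zero_of_re_pos (by simp; linarith)
  rw [← Gammaℝ_mul_Gammaℝ_add_one, inv_pow, inv_pow]
  field_simp
  ring

end Literature.NumberTheory.LFunctions

end
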